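import Summits.ResolutionOfSingularities.ResolutionOfSingularities.Theorems.FrobeniusLadderFInjectiveMacaulayficationCINondegenerateDefs
import Summits.ResolutionOfSingularities.ResolutionOfSingularities.Theorems.FrobeniusLadderFInjectiveMacaulayficationNewtonChartHonAnyField
import HarnessLib

/-!
# (A2) THE CI-ISHII CHART LEMMA: on a refining unimodular chart, the strict transforms of a Newton non-degenerate COMPLETE INTERSECTION have a rank-`r` Jacobian off
# every stratum over the origin (any field, geometric non-degeneracy)
# (crux `FInjectiveMacaulayfication` stmt-ResolutionOfSingularities-15315, chain w45a; res-L1-w45a-plan-1 RULINGs R23.2 (4)(ii) / R23.3 (A2) GO; seat res-L1-w45a-stub-2 g12; the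
# `r`-equation twin of ✓ `NewtonChartLemma.ishii_lemma_4_4_24(_weak)` (res-L1-w45a-stub-1 / stub-3), whose per-equation identities (4.12)/(4.13) it reuses verbatim)

[OURS · L1 W4.5a] Support file (`--supports stmt-ResolutionOfSingularities-15315 --as helper`); def-free; UNCONDITIONAL; no named fact; NOT a statement of any manuscript.
AI-written (AI review is weaker than expert review). Nothing of the crux is proved here.

SETTING. `F₀, …, F_{r−1} ∈ k[X₀..X_{m−1}]`; ONE unimodular exponent matrix `V` whose cone refines the dual Newton fan of EVERY `F_l`: `θ_V F_l = Y^{e_l}·g_l`, `g_l(0) ≠ 0`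
(`θ_V : X_j ↦ ∏ᵢ Yᵢ^{V i j}`); a set of rows `S` with strictly positive sum (the orbit lies over the origin); a point `y` of the orbit (`yᵢ = 0 ⟺ i ∈ S`) at which ALL `g_l`
vanish. CLAIM (`ci_rank_of_chart_field`, one field): if `(F_l)` is CI-Newton-non-degenerate along every positive weight (`CINondegenerate.IsCINondegenerateAlong`, Khovanskii form:
at common torus zeros of the initial forms the gradient rows are linearly independent), then the rows `(∂g_l/∂Yᵢ (y))_{i ∉ S}`, `l < r`, are LINEARLY INDEPENDENT — the strict
transforms cut out, near `y`, a regular complete intersection TRANSVERSAL to the orbit. PROOF (Ishii pp. 96–97 run for each `l`, then linear algebra): with the torus point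
`x_j = ∏_{i∉S} yᵢ^{V i j}`, the units `C_l = ∏_{i∉S} yᵢ^{e_{l,i}}` and `u_{l,j} = (X_j ∂_j f_{l,F})(x)` (`f_{l,F}` = face polynomial of `F_l` for the weight `Σ_{i∈S} row i`):
(4.13) `f_{l,F}(x) = 0`; (4.12) `(V·u_l)_i = C_l·yᵢ·∂ᵢg_l(y)` for `i ∉ S` and `= 0` for `i ∈ S`. A relation `Σ_l λ_l ∂ᵢg_l(y) = 0` (`i ∉ S`) gives, with `μ_l = λ_l/C_l`,
`V·(Σ_l μ_l u_l) = 0`, so `Σ_l μ_l u_l = 0` (unimodularity), so `Σ_l μ_l ∂_j f_{l,F}(x) = 0` for all `j` (`x_j ≠ 0`) — and CI non-degeneracy at the common torus zero `x` forces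
`μ = 0`, hence `λ = 0`.
* §1 `linearIndependent_eval_pderiv_of_ciNondegenerate` — CI non-degeneracy in polynomial terms (initial form = face polynomial, ✓`initialForm_coe`);
* §2 ★★ `ci_rank_of_chart_field` — the lemma over one field `K` (rational point `y ∈ Kᵐ`);
* §3 ★★ `ci_rank_of_chart` — the GEOMETRIC form: `F_l ∈ k[X]`, `map (algebraMap k K) ∘ F` CI-non-degenerate, `y ∈ Kᵐ` a geometric point (✓`NewtonChartHonAnyField.map_theta`).
For `r = 1` these are ✓`ishii_lemma_4_4_24_weak` (by ✓`CINondegenerate.isCINondegenerateAlong_one_iff`).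
[cite: IshiiSingularities2018, Lemma 4.4.24 (pp. 96–97)] [cite: CuetoPopescupampuStepanov2023, Def. 4.2 (p. 12)] [cite: BoubakriGreuelMarkwig2010, §3 (p. 10)]
-/

-- single-problem summit: the doubled namespace component is forced
set_option linter.dupNamespace false

noncomputable section

open MvPolynomial

namespace Summit.ResolutionOfSingularities.ResolutionOfSingularities.Theorems.FInjectiveMacaulayfication.CINewtonChartLemma

open Summit.ResolutionOfSingularities.ResolutionOfSingularities.Theorems.FInjectiveMacaulayfication
open Literature.AlgebraicGeometry.Resolution Literature.AlgebraicGeometry.Resolution.BoubakriGreuelMarkwig CINondegenerate NewtonChartLemma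

variable {K : Type} [Field K] {m r : ℕ}

/-! ## §1 CI non-degeneracy in polynomial terms -/

/-- **CI NON-DEGENERACY IN POLYNOMIAL TERMS**: if `(F_l)` is CI-non-degenerate along every positive weight, then for a positive integer weight `w`, the face polynomials
`f_{l,F} = Σ_{α ∈ F_l} a_α X^α` (`F_l` = exponents of `F_l` of minimal `w`-weight) and a `K`-rational torus point `q` with `f_{l,F}(q) = 0` for all `l`, the gradient rows
`(∂_j f_{l,F}(q))_j` are linearly independent. [cite: CuetoPopescupampuStepanov2023, Def. 4.2; BoubakriGreuelMarkwig2010, §3 (p. 10)] -/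
theorem linearIndependent_eval_pderiv_of_ciNondegenerate (F : Fin r → MvPolynomial (Fin m) K)
    (hND : ∀ w : Fin m → ℝ, (∀ i, 0 < w i) → IsCINondegenerateAlong w (fun l => (F l : MvPowerSeries (Fin m) K)))
    (w : Fin m → ℕ) (hw : ∀ i, 0 < w i) (Fc : Fin r → Finset (Fin m →₀ ℕ))
    (hF : ∀ l α, α ∈ Fc l ↔ α ∈ (F l).support ∧ ∀ β ∈ (F l).support, ∑ j, w j * α j ≤ ∑ j, w j * β j)
    (q : Fin m → K) (hq : ∀ i, q i ≠ 0) (h0 : ∀ l, MvPolynomial.eval q (∑ α ∈ Fc l, monomial α (coeff α (F l))) = 0) :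
    LinearIndependent K (fun l : Fin r => fun j : Fin m => MvPolynomial.eval q (pderiv j (∑ α ∈ Fc l, monomial α (coeff α (F l))))) := by
  have h := hND (fun i => (w i : ℝ)) (fun i => by exact_mod_cast hw i) q hq
  have hin : ∀ l, initialForm (fun i => (w i : ℝ)) (F l : MvPowerSeries (Fin m) K) =
      ((∑ α ∈ Fc l, monomial α (coeff α (F l)) : MvPolynomial (Fin m) K) : MvPowerSeries (Fin m) K) := fun l => initialForm_coe (F l) w (Fc l) (hF l)
  simp only [hin, pderiv_coe, evalAt_coe] at h
  exact h h0

/-! ## §2 ★★ The lemma over one field -/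

/-- ★★ **CI-ISHII CHART LEMMA (one field).** See the module docstring: at a `K`-point `y` of the orbit `{yᵢ = 0 ⟺ i ∈ S}` over the origin where all strict transforms `g_l`
vanish, the rows `(∂ᵢ g_l (y))_{i ∉ S}` are linearly independent over `K`. [cite: IshiiSingularities2018, Lemma 4.4.24 (pp. 96–97); CuetoPopescupampuStepanov2023, Def. 4.2] -/
theorem ci_rank_of_chart_field (F : Fin r → MvPolynomial (Fin m) K)
    (hND : ∀ w : Fin m → ℝ, (∀ i, 0 < w i) → IsCINondegenerateAlong w (fun l => (F l : MvPowerSeries (Fin m) K)))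
    (V : Matrix (Fin m) (Fin m) ℕ) (hV : IsUnit (V.map (Nat.cast : ℕ → ℤ)).det)
    (e : Fin r → (Fin m →₀ ℕ)) (g : Fin r → MvPolynomial (Fin m) K)
    (hθ : ∀ l, aeval (fun j : Fin m => ∏ i : Fin m, (X i : MvPolynomial (Fin m) K) ^ V i j) (F l) = monomial (e l) 1 * g l)
    (hg0 : ∀ l, constantCoeff (g l) ≠ 0) (S : Finset (Fin m)) (hpos : ∀ j : Fin m, 0 < ∑ i ∈ S, V i j)
    (y : Fin m → K) (hy : ∀ i : Fin m, y i = 0 ↔ i ∈ S) (hgy : ∀ l, MvPolynomial.eval y (g l) = 0) :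
    LinearIndependent K (fun l : Fin r => fun i : {i : Fin m // i ∉ S} => MvPolynomial.eval y (pderiv (i : Fin m) (g l))) := by
  classical
  -- the exponent map, the torus point, the units
  set v : (Fin m →₀ ℕ) → (Fin m →₀ ℕ) := fun α => Finsupp.equivFunOnFinite.symm fun i => ∑ j, V i j * α j with hvdef
  have hv : ∀ α i, v α i = ∑ j, V i j * α j := fun α i => by simp [hvdef]
  set x : Fin m → K := fun j => ∏ i ∈ Sᶜ, y i ^ V i j with hxdef
  have hx : ∀ j, x j = ∏ i ∈ Sᶜ, y i ^ V i j := fun j => rfl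
  have hyT : ∀ i ∈ Sᶜ, y i ≠ 0 := fun i hi h0 => (Finset.mem_compl.mp hi) ((hy i).mp h0)
  have hxT : ∀ j, x j ≠ 0 := fun j => Finset.prod_ne_zero_iff.mpr fun i hi => pow_ne_zero _ (hyT i hi)
  set C : Fin r → K := fun l => ∏ i ∈ Sᶜ, y i ^ (e l) i with hCdef
  have hC0 : ∀ l, C l ≠ 0 := fun l => Finset.prod_ne_zero_iff.mpr fun i hi => pow_ne_zero _ (hyT i hi)
  -- the faces and the face polynomials
  set Fc : Fin r → Finset (Fin m →₀ ℕ) := fun l => (F l).support.filter (fun α => ∀ i ∈ S, v α i = (e l) i) with hFcdef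
  -- (4.13) per equation: `f_{l,F}(x) = 0`
  have h13 : ∀ l, MvPolynomial.eval x (∑ α ∈ Fc l, monomial α (coeff α (F l))) = 0 := by
    intro l
    have h := C_mul_eval_g V hV (F l) v hv (e l) (g l) (hθ l) S y hy x hx (C l) rfl
    rw [hgy l, mul_zero] at h
    exact h.symm
  -- (4.12) per equation: `(V·u_l)_i = C_l·yᵢ·∂ᵢ g_l(y)` off `S`, `= 0` on `S`
  have hW : ∀ (l : Fin r) (i : Fin m), ∑ j, (V i j : K) * MvPolynomial.eval x (X j * pderiv j (∑ α ∈ Fc l, monomial α (coeff α (F l)))) =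
      if i ∈ S then 0 else C l * (y i * MvPolynomial.eval y (pderiv i (g l))) := by
    intro l i
    rw [sum_V_mul_u V (F l) v hv (Fc l) S y x hx i]
    by_cases hi : i ∈ S
    · rw [if_pos hi, hFcdef, W_of_mem V (F l) v hv (e l) S y x hx i hi]
      have := h13 l
      rw [hFcdef] at this
      rw [this, mul_zero]
    · rw [if_neg hi]
      have h := C_mul_mul_eval_pderiv_g V hV (F l) v hv (e l) (g l) (hθ l) S y hy x hx (C l) rfl i
      have h13' := h13 l
      rw [hFcdef] at h13'
      rw [hFcdef, h, h13', mul_zero, sub_zero]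
  -- CI non-degeneracy at the torus point `x`: the gradient rows of the face polynomials are independent
  have hLI := linearIndependent_eval_pderiv_of_ciNondegenerate F hND (fun j => ∑ i ∈ S, V i j) hpos Fc
    (fun l α => by rw [hFcdef]; exact mem_face_iff V hV (F l) v hv (e l) (g l) (hθ l) (hg0 l) S α) x hxT h13
  -- linear independence of the strict-transform rows off `S`
  rw [Fintype.linearIndependent_iff]
  intro lam hrel l₀
  -- the relation, coordinatewise off `S`
  have hreli : ∀ i : Fin m, i ∉ S → ∑ l, lam l * MvPolynomial.eval y (pderiv i (g l)) = 0 := by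
    intro i hi
    have := congr_fun hrel ⟨i, hi⟩
    simpa only [Finset.sum_apply, Pi.smul_apply, smul_eq_mul, Pi.zero_apply] using this
  -- `μ_l = λ_l / C_l`; `U_j = Σ_l μ_l u_{l,j}` satisfies `V·U = 0`
  set μ : Fin r → K := fun l => lam l / C l with hμdef
  set U : Fin m → K := fun j => ∑ l, μ l * MvPolynomial.eval x (X j * pderiv j (∑ α ∈ Fc l, monomial α (coeff α (F l)))) with hUdef
  have hVU : ∀ i : Fin m, ∑ j, (V i j : K) * U j = 0 := by
    intro i
    have hswap : ∑ j, (V i j : K) * U j = ∑ l, μ l * ∑ j, (V i j : K) * MvPolynomial.eval x (X j * pderiv j (∑ α ∈ Fc l, monomial α (coeff α (F l)))) := by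
      simp only [hUdef, Finset.mul_sum]
      rw [Finset.sum_comm]
      exact Finset.sum_congr rfl fun l _ => Finset.sum_congr rfl fun j _ => by ring
    rw [hswap]
    by_cases hi : i ∈ S
    · exact Finset.sum_eq_zero fun l _ => by rw [hW l i, if_pos hi, mul_zero]
    · have hterm : ∀ l, μ l * (C l * (y i * MvPolynomial.eval y (pderiv i (g l)))) = y i * (lam l * MvPolynomial.eval y (pderiv i (g l))) := by
        intro l
        rw [hμdef]
        field_simp [hC0 l]
      calc ∑ l, μ l * ∑ j, (V i j : K) * MvPolynomial.eval x (X j * pderiv j (∑ α ∈ Fc l, monomial α (coeff α (F l))))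
          = ∑ l, y i * (lam l * MvPolynomial.eval y (pderiv i (g l))) := Finset.sum_congr rfl fun l _ => by rw [hW l i, if_neg hi, hterm l]
        _ = y i * ∑ l, lam l * MvPolynomial.eval y (pderiv i (g l)) := by rw [Finset.mul_sum]
        _ = 0 := by rw [hreli i hi, mul_zero]
  have hU : U = 0 := by
    refine Matrix.eq_zero_of_mulVec_eq_zero (det_cast_ne_zero (k := K) V hV) ?_
    ext i
    rw [Matrix.mulVec, dotProduct, Pi.zero_apply]
    simpa [Matrix.map_apply] using hVU i
  -- hence `Σ_l μ_l ∂_j f_{l,F}(x) = 0` for all `j` (`x_j ≠ 0`)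
  have hgrad : ∑ l, μ l • (fun j : Fin m => MvPolynomial.eval x (pderiv j (∑ α ∈ Fc l, monomial α (coeff α (F l))))) = 0 := by
    funext j
    have hUj : U j = 0 := by rw [hU]; rfl
    rw [hUdef] at hUj
    simp only [map_mul, eval_X] at hUj
    have : x j * ∑ l, μ l * MvPolynomial.eval x (pderiv j (∑ α ∈ Fc l, monomial α (coeff α (F l)))) = 0 := by
      rw [Finset.mul_sum, ← hUj]
      exact Finset.sum_congr rfl fun l _ => by ring
    have hz := (mul_eq_zero.mp this).resolve_left (hxT j)
    simpa only [Finset.sum_apply, Pi.smul_apply, smul_eq_mul, Pi.zero_apply] using hz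
  have hμ0 : μ l₀ = 0 := (Fintype.linearIndependent_iff.mp hLI) μ hgrad l₀
  -- `λ_{l₀} = μ_{l₀}·C_{l₀} = 0`
  have : lam l₀ = μ l₀ * C l₀ := by rw [hμdef, div_mul_cancel₀ _ (hC0 l₀)]
  rw [this, hμ0, zero_mul]

/-! ## §3 ★★ The geometric form (any field) -/

/-- ★★ **CI-ISHII CHART LEMMA, GEOMETRIC FORM (ANY FIELD).** `F_l ∈ k[X]` with `map (algebraMap k K) ∘ F` CI-non-degenerate along every positive weight over an extension field
`K ⊇ k`; one unimodular chart refining every dual Newton fan (`θ_V F_l = Y^{e_l}·g_l`, `g_l(0) ≠ 0`); a stratum `S` over the origin and a GEOMETRIC point `y ∈ Kᵐ` of its orbit with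
`aeval y (g l) = 0` for all `l`. THEN the rows `(aeval y (∂ᵢ g_l))_{i ∉ S}` are linearly independent over `K`. (§2 over `K` for `map F_l`, `map g_l` via ✓`NewtonChartHonAnyField.map_theta`.)
[cite: IshiiSingularities2018, Lemma 4.4.24; CuetoPopescupampuStepanov2023, Def. 4.2] -/
theorem ci_rank_of_chart {k : Type} [Field k] (K' : Type) [Field K'] [Algebra k K'] (F : Fin r → MvPolynomial (Fin m) k)
    (hND : ∀ w : Fin m → ℝ, (∀ i, 0 < w i) →
      IsCINondegenerateAlong w (fun l => ((map (algebraMap k K') (F l) : MvPolynomial (Fin m) K') : MvPowerSeries (Fin m) K')))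
    (V : Matrix (Fin m) (Fin m) ℕ) (hV : IsUnit (V.map (Nat.cast : ℕ → ℤ)).det)
    (e : Fin r → (Fin m →₀ ℕ)) (g : Fin r → MvPolynomial (Fin m) k)
    (hθ : ∀ l, aeval (fun j : Fin m => ∏ i : Fin m, (X i : MvPolynomial (Fin m) k) ^ V i j) (F l) = monomial (e l) 1 * g l)
    (hg0 : ∀ l, constantCoeff (g l) ≠ 0) (S : Finset (Fin m)) (hpos : ∀ j : Fin m, 0 < ∑ i ∈ S, V i j)
    (y : Fin m → K') (hy : ∀ i : Fin m, y i = 0 ↔ i ∈ S) (hgy : ∀ l, aeval y (g l) = 0) :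
    LinearIndependent K' (fun l : Fin r => fun i : {i : Fin m // i ∉ S} => aeval y (pderiv (i : Fin m) (g l))) := by
  have hθ' : ∀ l, aeval (fun j : Fin m => ∏ i : Fin m, (X i : MvPolynomial (Fin m) K') ^ V i j) (map (algebraMap k K') (F l)) =
      monomial (e l) 1 * map (algebraMap k K') (g l) := fun l => NewtonChartHonAnyField.map_theta K' (algebraMap k K') (F l) V (e l) (g l) (hθ l)
  have hg0' : ∀ l, constantCoeff (map (algebraMap k K') (g l)) ≠ 0 := fun l => by
    rw [constantCoeff_map]
    exact fun h0 => hg0 l ((algebraMap k K').injective (by rw [h0, map_zero]))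
  have hgy' : ∀ l, MvPolynomial.eval y (map (algebraMap k K') (g l)) = 0 := fun l => by rw [eval_map, ← aeval_def]; exact hgy l
  have h := ci_rank_of_chart_field (fun l => map (algebraMap k K') (F l)) hND V hV e (fun l => map (algebraMap k K') (g l)) hθ' hg0' S hpos y hy hgy'
  have hfun : (fun l : Fin r => fun i : {i : Fin m // i ∉ S} => MvPolynomial.eval y (pderiv (i : Fin m) (map (algebraMap k K') (g l)))) =
      fun l : Fin r => fun i : {i : Fin m // i ∉ S} => aeval y (pderiv (i : Fin m) (g l)) := by
    funext l i
    rw [pderiv_map, eval_map, ← aeval_def]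
  rw [hfun] at h
  exact h

end Summit.ResolutionOfSingularities.ResolutionOfSingularities.Theorems.FInjectiveMacaulayfication.CINewtonChartLemma

end
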